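import Mathlib
import Summits.ValiantsHypothesis.ValiantsHypothesis.Theses.BarrierLever
import Summits.ValiantsHypothesis.ValiantsHypothesis.Theorems.BarrierLeverPrincipalMinorLayoutsNonsingularRefutation
import Summits.ValiantsHypothesis.ValiantsHypothesis.Theorems.BarrierLeverTransversalSufficesForPrincipal
import Summits.ValiantsHypothesis.ValiantsHypothesis.Theorems.BarrierLeverSplitReductionSufficesForTransversal
import Summits.ValiantsHypothesis.ValiantsHypothesis.Theorems.BarrierLeverTransversalLiteralPairSplit
import Summits.ValiantsHypothesis.ValiantsHypothesis.Theorems.BarrierLeverTransversalTwinFreeReductionHolds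
import Summits.ValiantsHypothesis.ValiantsHypothesis.Theorems.BarrierLeverChainCertificatesDecideTheCore
import Summits.ValiantsHypothesis.ValiantsHypothesis.Theorems.BarrierLeverChainCertificateSufficesHolds

/-!
# Route BarrierLever — item `ChainCertificatesExistOnIrreducibleLayouts` (stmt-ValiantsHypothesis-19658): REFUTATION

Refutation file (`--workitem stmt-ValiantsHypothesis-19658`; cell valiant-natproofs, rung V4, 𝒟-side;
prover seat val-np-p3 gen 4). Definition-free; a corollary of the refutation of TNS
(`TNSRefutation.not_PrincipalMinorLayoutsNonsingular`, item 19126: at `h = 31` the layout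
`u = (∅, {0}, …, {30})`, `w =` all subsets of `{0,…,4}` has a singular principal-minor layout
matrix for EVERY `K`) through arrows already in the tree.

**`not_ChainCertificatesExistOnIrreducibleLayouts`**: chain certificates do NOT exist on every irreducible
layout, since `ChainCertificateSuffices → ChainCertificatesExistOnIrreducibleLayouts → (TT on irreducible
layouts)` (item 19659, `ChainGlue.chainCertificatesDecideTheCore`) with 19651 proved, then 19617, 19153, and
TNS false.

WHAT THIS IS NOT: item 19717 `PartitionMinorsHitByVP` (layout-dependent witnesses) is untouched;
nothing on crux stmt-14610 or `VP` vs `VNP`.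
-/

set_option linter.dupNamespace false

namespace Summit.ValiantsHypothesis.ValiantsHypothesis.Theorems.BarrierLever.TNSRefutation

/-- **Chain certificates do not exist on every irreducible layout** (item
`ChainCertificatesExistOnIrreducibleLayouts`, stmt-ValiantsHypothesis-19658): by the proved glues 19659
(with 19651) and 19617 (with 19587, 19588), TT ⇒ TNS (19153) and the refutation of TNS. -/
theorem not_ChainCertificatesExistOnIrreducibleLayouts :
    ¬ Summit.ValiantsHypothesis.ValiantsHypothesis.Theses.BarrierLever.ChainCertificatesExistOnIrreducibleLayouts :=
  fun hC => not_PrincipalMinorLayoutsNonsingular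
    (TransversalDictionary.transversalSufficesForPrincipal
      (SplitGlue.splitReductionSufficesForTransversal LiteralSplit.transversalLiteralPairSplit_route
        LiteralLift.transversalTwinFreeReduction_route
        (ChainGlue.chainCertificatesDecideTheCore ChainCert.chainCertificateSuffices_route hC)))

end Summit.ValiantsHypothesis.ValiantsHypothesis.Theorems.BarrierLever.TNSRefutation
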